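import Summits.Ventures.HSemireg.HomComplexSigma
import Summits.Ventures.HSemireg.BifunctorMappingCone
import Literature.AlgebraicGeometry.Modules.ModulesGrothendieckAbelian
import Mathlib.CategoryTheory.Abelian.GrothendieckAxioms.Basic
import Mathlib.Algebra.Homology.ShortComplex.ExactFunctor
import HarnessLib

/-!
# `𝓗om•(K•, –)` maps short exact sequences of complexes to short exact sequences (`K•` termwise finite locally free)

For a scheme `X` and a cochain complex `K•` of `𝒪_X`-modules with every `Kᵖ` finite locally free, the internal-Hom
complex functor `𝓗om•(K•, –) = HomComplex.homFunctor X K` (t-7, `HomComplexSigma.lean`; Mathlib's total complex of the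
bicomplex `(q, i) ↦ 𝓗om(K^{-i}, L^q)` in the FIRST variable `L`) sends a short exact sequence of cochain complexes
`0 → L₁ → L₂ → L₃ → 0` to a short exact sequence (`homFunctor_map_shortExact`).  Degreewise this is the coproduct, over
the fibre `{(q, i) | q + i = n}`, of the short exact sequences `0 → 𝓗om(K^{-i}, L₁^q) → 𝓗om(K^{-i}, L₂^q) → 𝓗om(K^{-i}, L₃^q) → 0`
(`𝓗om(E, –)` is exact for `E` finite locally free, `Modules/SheafHomExact.lean`), and coproducts of short exact
sequences in `Mod(𝒪_X)` are short exact because `Mod(𝒪_X)` is AB5, hence AB4 (`Modules/ModulesGrothendieckAbelian.lean`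
+ Mathlib `AB4.of_AB5`): `shortExact_sigmaMap`.

This is the hypothesis `hS'` of `BifunctorCone.shiftedHomMap_triangleOfSESδ` (`DerivedDescentTriangle.lean`) in the case
`Φ = 𝓗om•(K•, –)`.

HONEST FRAMING (cell pub-hsemireg, seat gs-g4): generic plumbing; NOT a door, NOT a named fact; nothing here says HC,
HC_CM or HC_AV is proved.

## References
* A. Grothendieck, *Sur quelques points d'algèbre homologique*, Tôhoku Math. J. 9 (1957), 1.5 (AB4/AB5), 3.1.1. [folklore]
* Mathlib: `CategoryTheory.Abelian.GrothendieckAxioms.Basic` (`AB4.of_AB5`, `HasExactColimitsOfShape`).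
-/

noncomputable section

set_option backward.isDefEq.respectTransparency false

open CategoryTheory CategoryTheory.Category CategoryTheory.Limits

namespace Summit.Ventures.HSemireg

/-! ### Coproducts of short exact sequences (AB4) -/

section Sigma

universe w v u

variable {C : Type u} [Category.{v} C] [Abelian C]

/-- In a functor category, a short complex which is exact after each evaluation is exact (homology is computed
objectwise). [folklore] -/
lemma exact_of_evaluation {D : Type*} [Category D] (T : ShortComplex (D ⥤ C))
    (h : ∀ j, (T.map ((evaluation D C).obj j)).Exact) : T.Exact := by
  rw [ShortComplex.exact_iff_isZero_homology, Functor.isZero_iff]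
  intro j
  refine IsZero.of_iso ?_ (T.mapHomologyIso ((evaluation D C).obj j)).symm
  rw [← ShortComplex.exact_iff_isZero_homology]
  exact h j

/-- A short complex in a functor category which is short exact after each evaluation is short exact. [folklore] -/
lemma shortExact_of_evaluation {D : Type*} [Category D] (T : ShortComplex (D ⥤ C))
    (h : ∀ j, (T.map ((evaluation D C).obj j)).ShortExact) : T.ShortExact where
  exact := exact_of_evaluation T fun j => (h j).exact
  mono_f := by
    haveI : ∀ j, Mono (T.f.app j) := fun j => (h j).mono_f
    exact NatTrans.mono_of_mono_app _
  epi_g := by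
    haveI : ∀ j, Epi (T.g.app j) := fun j => (h j).epi_g
    exact NatTrans.epi_of_epi_app _

variable {J : Type w} [HasCoproducts.{w} C] [HasExactColimitsOfShape (Discrete J) C]

/-- **A coproduct of short exact sequences is short exact** in an abelian category with exact `J`-indexed coproducts
(AB4 for `J`). [folklore] -/
theorem shortExact_sigmaMap (S : J → ShortComplex C) (hS : ∀ j, (S j).ShortExact) :
    (ShortComplex.mk (Limits.Sigma.map fun j => (S j).f) (Limits.Sigma.map fun j => (S j).g)
      (by ext j; simp)).ShortExact := by
  -- the short complex of functors `Discrete J ⥤ C`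
  let T : ShortComplex (Discrete J ⥤ C) := ShortComplex.mk
    (Discrete.natTrans (F := Discrete.functor fun j => (S j).X₁) (G := Discrete.functor fun j => (S j).X₂)
      fun j => (S j.as).f)
    (Discrete.natTrans (F := Discrete.functor fun j => (S j).X₂) (G := Discrete.functor fun j => (S j).X₃)
      fun j => (S j.as).g)
    (by ext ⟨j⟩; simp)
  have hT : T.ShortExact := shortExact_of_evaluation T fun ⟨j⟩ => by
    refine ShortComplex.shortExact_of_iso ?_ (hS j)
    exact ShortComplex.isoMk (Iso.refl _) (Iso.refl _) (Iso.refl _) (by simp [T]) (by simp [T])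
  haveI : PreservesFiniteColimits (colim : (Discrete J ⥤ C) ⥤ C) := by infer_instance
  have hT' := hT.map_of_exact (colim : (Discrete J ⥤ C) ⥤ C)
  exact ShortComplex.shortExact_of_iso
    (ShortComplex.isoMk (Iso.refl _) (Iso.refl _) (Iso.refl _) (by cat_disch) (by cat_disch)) hT'

end Sigma

/-! ### `Mod(𝒪_X)` is AB4; `𝓗om•(K•, –)` preserves short exact sequences -/

section Modules

universe u

open AlgebraicGeometry Literature.AlgebraicGeometry.Modules Literature.AlgebraicGeometry.Motives

variable {X : Scheme.{u}}

/-- `Mod(𝒪_X)` is AB4 (coproducts are exact), from AB5 (`Modules/ModulesGrothendieckAbelian.lean`) by Mathlib's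
`AB4.of_AB5`.  A theorem, not an instance (same policy as `isGrothendieckAbelian_modules`).
[cite: Grothendieck1957Tohoku, Prop. 3.1.2] -/
theorem ab4_modules (X : Scheme.{u}) : AB4OfSize.{u} X.Modules :=
  haveI : AB5OfSize.{u, u} X.Modules := sheafOfModules_ab5 X.ringCatSheaf
  haveI : HasFiniteBiproducts X.Modules := HasFiniteBiproducts.of_hasFiniteProducts
  AB4.of_AB5 _

/-- Small-indexed coproducts in `Mod(𝒪_X)` are exact. [folklore] -/
theorem hasExactColimitsOfShape_discrete_modules (X : Scheme.{u}) (J : Type) :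
    HasExactColimitsOfShape (Discrete J) X.Modules := by
  haveI := ab4_modules X
  infer_instance

variable (K : CochainComplex X.Modules ℤ) (hK : ∀ p, IsFiniteLocallyFree (K.X p))

/-- The degree-`n` component of `𝓗om•(K•, φ)` is the coproduct, over the fibre `q + i = n`, of the maps
`𝓗om(K^{-i}, φ^q)`. [folklore] -/
lemma homFunctor_map_f_eq_sigmaMap {L L' : CochainComplex X.Modules ℤ} (φ : L ⟶ L') (n : ℤ) :
    ((HomComplex.homFunctor X K).map φ).f n =
      Limits.Sigma.map fun idx : ↥(ComplexShape.π (ComplexShape.up ℤ) (ComplexShape.up ℤ) (ComplexShape.up ℤ) ⁻¹' {n}) =>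
        sheafHomMap (K.X (-idx.1.2)) (φ.f idx.1.1) := by
  refine Limits.Sigma.hom_ext _ _ fun idx => ?_
  rw [Limits.Sigma.ι_map]
  erw [HomologicalComplex.ι_mapBifunctorMap φ (𝟙 (dualComplex X K)) (sheafHomBifunctor X).flip
    (ComplexShape.up ℤ) idx.1.1 idx.1.2 n idx.2, HomologicalComplex.id_f, CategoryTheory.Functor.map_id,
    Category.id_comp]
  rfl

include hK in
/-- **`𝓗om•(K•, –)` maps short exact sequences of cochain complexes to short exact sequences** when every `Kᵖ` is
finite locally free (degreewise a coproduct of the short exact sequences `𝓗om(K^{-i}, 0 → L₁^q → L₂^q → L₃^q → 0)`).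
[cite: Hartshorne1977, III.6 (proof of Prop. 6.5)] -/
theorem homFunctor_map_shortExact {S : ShortComplex (CochainComplex X.Modules ℤ)} (hS : S.ShortExact) :
    (S.map (HomComplex.homFunctor X K)).ShortExact := by
  refine HomologicalComplex.shortExact_of_degreewise_shortExact _ fun n => ?_
  haveI := hasExactColimitsOfShape_discrete_modules X
    ↥(ComplexShape.π (ComplexShape.up ℤ) (ComplexShape.up ℤ) (ComplexShape.up ℤ) ⁻¹' {n})
  -- the family of short exact sequences `𝓗om(K^{-i}, S^q)`
  let T : ↥(ComplexShape.π (ComplexShape.up ℤ) (ComplexShape.up ℤ) (ComplexShape.up ℤ) ⁻¹' {n}) →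
      ShortComplex X.Modules := fun idx =>
    (S.map (HomologicalComplex.eval _ _ idx.1.1)).map (sheafHomFunctor (K.X (-idx.1.2)))
  have hT : ∀ idx, (T idx).ShortExact := fun idx => by
    haveI := preservesFiniteColimits_sheafHomFunctor (K.X (-idx.1.2)) (hK _)
    exact (hS.map_of_exact (HomologicalComplex.eval _ _ idx.1.1)).map_of_exact (sheafHomFunctor (K.X (-idx.1.2)))
  refine ShortComplex.shortExact_of_iso ?_ (shortExact_sigmaMap T hT)
  exact ShortComplex.isoMk (Iso.refl _) (Iso.refl _) (Iso.refl _)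
    (by rw [Iso.refl_hom, Iso.refl_hom, Category.id_comp, Category.comp_id]
        exact (homFunctor_map_f_eq_sigmaMap K S.f n).symm)
    (by rw [Iso.refl_hom, Iso.refl_hom, Category.id_comp, Category.comp_id]
        exact (homFunctor_map_f_eq_sigmaMap K S.g n).symm)

end Modules

end Summit.Ventures.HSemireg

end
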